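import Literature.Topology.FourManifolds.SigmaBarTubeZoneAgreements
import Literature.Topology.FourManifolds.TubeFibreProfiles
import Literature.Topology.FourManifolds.PlumbingModelPiece
import Literature.Geometry.Manifold.ThreePiecePatching
import HarnessLib

/-!
# The first sheet of the tube of `Σ̄₂ ⊂ T⁴ # ℂℙ²bar`

Topic `Literature/Topology/FourManifolds` (fact seat of the Seiberg–Witten leaf
`Literature.Barriers.SmoothPoincare4.akhmedovPark2010_lemma8_invariants`; block 2 of
Akhmedov–Park's `X₁(m)`, A. Akhmedov, B. D. Park, Invent. Math. 181 (2010), §3).  Over the first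
torus `T ∖ {x₂}` (the sheet `S₁ = T × {y₀}` of `T⁴` punctured at the resolved double point), the
tube of the genus-2 surface `Σ̄₂ ⊂ Z = T⁴ # ℂℙ²` is the map `ΦA : T × ℝ² → Z` given by three
formulas on three parameter zones:

* NECK zone `U_N = {0 < ‖a₂‖ < 2}` (quarter chart `a₂` at `x₂`): `jX (Nk (p, ṽ))`, the resolution
  neck piece (`ResolutionNeckPiece.lean`, fibre scale `k = c ϱ₀`);
* CAP zone `U_C = {‖a₃‖ < 3/4}` (quarter chart `a₃` at the blown-up double point `x₃`):
  `jP ((affineChart 0)⁻¹ (C (a₃ p, k₃ ṽ)))`, the blow-up cap in `ℂℙ²` (`BlowUpLineCapTube.lean`);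
* FAR zone `U_F`: `jX (T₁ (p, vc (Ψ₁ p · cx ṽ)))`, the product tube with fibre turned and scaled
  by the multiplier `Ψ₁` (`TubeFibreProfiles.lean`),

`jX : X → Z`, `jP : ℂℙ² → Z` the two inclusions of the connected sum.  With all local data bound
by hypotheses (discharged in the instantiation file) we prove: the formulas agree on the overlaps
(`sheetOne_agreements`, from `SigmaBarTubeZoneAgreements.lean` and the exactness of `Ψ₁` near
`x₂`, `x₃`), hence `ΦA` equals each formula on its whole zone (`sheetOne_eqOn`); `ΦA` is smooth on
`(T ∖ {x₂}) × B(0, ρ₀)` (`contMDiffOn_sheetOne`); and each piece is injective on its zone with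
open images and a smooth left inverse (`sheetOne_neck_piece`, `sheetOne_cap_piece`,
`sheetOne_far_piece`).  Everything is proved; no definitions.

## References

* A. Akhmedov, B. D. Park, Invent. Math. 181 (2010) 577–603 = arXiv:math/0701829, §3. [AkhmedovPark2010]
* J. M. Lee, *Introduction to Smooth Manifolds*, 2nd ed. (2013), Cor. 2.8, Prop. 5.2. [LeeSmoothManifolds2013]
-/

noncomputable section

open scoped Manifold ContDiff Topology ComplexConjugate
open Set Function Complex Metric
open Literature.Topology.FourManifolds.ToricBlowup
open Literature.Topology.FourManifolds.ComplexProjectiveSpace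
open Literature.Geometry.Manifold
open Classical

namespace Literature.Topology.FourManifolds

namespace SheetOne

variable {F : Type} [TopologicalSpace F] [ChartedSpace (EuclideanSpace ℝ (Fin 2)) F]
  {X : Type} [TopologicalSpace X] [ChartedSpace (EuclideanSpace ℝ (Fin 4)) X]
  {Z : Type} [TopologicalSpace Z] [ChartedSpace (EuclideanSpace ℝ (Fin 4)) Z]
  {cx : EuclideanSpace ℝ (Fin 2) → ℂ} {vc : ℂ → EuclideanSpace ℝ (Fin 2)}
  -- the inclusions of the two summands
  {jX : X → Z} {AX : Set X} {jP : ComplexProjectivePlane → Z} {AP : Set ComplexProjectivePlane}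
  -- the far piece
  {T : F × EuclideanSpace ℝ (Fin 2) → X} {Ψ : F → ℂ} {x₂ x₃ : F}
  {Θ : F × EuclideanSpace ℝ (Fin 2) → EuclideanSpace ℝ (Fin 2)} {UF : Set F} {ρ₀ ϱ₀ : ℝ}
  -- the neck piece
  {eF : OpenPartialHomeomorph F (EuclideanSpace ℝ (Fin 2))} {A : F → ℂ}
  {P : OpenPartialHomeomorph X (EuclideanSpace ℝ (Fin 4))} {c : ℝ}
  {N : ℂ × ℂ → ℂ × ℂ} {δN k : ℝ} {Nk : F × EuclideanSpace ℝ (Fin 2) → X} {UN : Set F}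
  -- the cap piece
  {eF₃ : OpenPartialHomeomorph F (EuclideanSpace ℝ (Fin 2))} {A₃ : F → ℂ}
  {P₃ : OpenPartialHomeomorph X (EuclideanSpace ℝ (Fin 4))}
  {C : ℂ × ℂ → ℂ × ℂ} {k₃ : ℝ} {Ck : F × EuclideanSpace ℝ (Fin 2) → ComplexProjectivePlane}
  {UC : Set F} {D : ConnectedSumData 4 X ComplexProjectivePlane}
  -- the patched map
  {ΦA : F × EuclideanSpace ℝ (Fin 2) → Z}

variable (hcx : ∀ v, cx v = ⟨v 0, v 1⟩)
  (hvc : ∀ z, vc z = z.re • EuclideanSpace.single 0 (1 : ℝ) + z.im • EuclideanSpace.single 1 (1 : ℝ))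
  (hjX : ContMDiffOn (𝓡 4) (𝓡 4) ∞ jX AX) (hjXi : InjOn jX AX)
  (hjXo : ∀ O, IsOpen O → O ⊆ AX → IsOpen (jX '' O))
  (hjP : ContMDiffOn (𝓡 4) (𝓡 4) ∞ jP AP) (hjPi : InjOn jP AP)
  (hjPo : ∀ O, IsOpen O → O ⊆ AP → IsOpen (jP '' O))
  -- far piece
  (hT : Manifold.IsSmoothEmbedding ((𝓡 2).prod (𝓡 2)) (𝓡 4) ∞ T) (hTo : IsOpen (range T))
  (hΨs : ContMDiffOn (𝓡 2) 𝓘(ℝ, ℂ) ∞ Ψ {p | p ≠ x₂}) (hΨ0 : ∀ p, p ≠ x₂ → p ≠ x₃ → Ψ p ≠ 0)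
  (hΘ : ∀ q, Θ q = vc (Ψ q.1 * cx q.2))
  (hUF : IsOpen UF) (hUF₂ : ∀ p ∈ UF, p ≠ x₂ ∧ p ≠ x₃)
  (hFA : ∀ p ∈ UF, ∀ w : EuclideanSpace ℝ (Fin 2), T (p, Θ (p, w)) ∈ AX)
  (hρ₀ : 0 < ρ₀) (hϱ₀ : 0 < ϱ₀)
  -- neck piece (`ResolutionNeckPiece.lean` data with `k = c ϱ₀`)
  (heF : eF ∈ IsManifold.maximalAtlas (𝓡 2) ∞ F) (heFt : eF.target = univ)
  (hA : ∀ p, A p = cx (eF p))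
  (hP : P ∈ IsManifold.maximalAtlas (𝓡 4) ∞ X) (hPt : P.target = univ)
  (hc : 0 < c)
  (hPT : ∀ p, p ∈ eF.source → ∀ v : EuclideanSpace ℝ (Fin 2),
    T (p, v) ∈ P.source ∧ toC2 (P (T (p, v))) = (A p, (c : ℂ) * cx v))
  (hδ : 0 < δN)
  (hN1 : ContDiffOn ℝ ∞ N {p : ℂ × ℂ | p.1 ≠ 0})
  (hN2 : ∀ v ρ : ℂ, 3 / 4 ≤ ‖v‖ → N (v, ρ) = (v, conj (((‖v‖⁻¹ : ℝ) : ℂ) * v) * ρ))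
  (hN3 : ∀ v ρ : ℂ, ‖v‖ ≤ 1 / 4 → N (v, ρ) =
    ((((‖v‖⁻¹ : ℝ) : ℂ) * v) * ρ, conj (((‖v‖⁻¹ : ℝ) : ℂ) * v) * (((1 - ‖v‖ : ℝ)) : ℂ)))
  (hN4 : InjOn N {p : ℂ × ℂ | p.1 ≠ 0 ∧ ‖p.2‖ < δN})
  (hN5 : ∀ p : ℂ × ℂ, p.1 ≠ 0 → ‖p.2‖ < δN →
    ∃ L : (ℂ × ℂ) ≃L[ℝ] (ℂ × ℂ), HasStrictFDerivAt N (L : ℂ × ℂ →L[ℝ] ℂ × ℂ) p)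
  (hN6 : ∀ p : ℂ × ℂ, p.1 ≠ 0 → ‖p.2‖ < δN → ‖(N p).2‖ < 1 ∧ (‖p.1‖ < 1 → ‖(N p).1‖ < 1))
  (hk : k = c * ϱ₀)
  (hNk : ∀ (p : F) (w : EuclideanSpace ℝ (Fin 2)),
    Nk (p, w) = P.symm (fromC2 (N (A p, (k : ℂ) * cx w))))
  (hUN : UN = {p | p ∈ eF.source ∧ A p ≠ 0 ∧ ‖A p‖ < 2})
  (hNA : ∀ p ∈ eF.source, A p ≠ 0 → ∀ w : EuclideanSpace ℝ (Fin 2), Nk (p, w) ∈ AX)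
  (hΨN : ∀ p ∈ eF.source, A p ≠ 0 → ‖A p‖ < 2 →
    Ψ p = ((ϱ₀ : ℝ) : ℂ) * conj (((‖A p‖⁻¹ : ℝ) : ℂ) * A p))
  (hx₂ : x₂ ∈ eF.source ∧ A x₂ = 0)
  (hρN : ρ₀ * (c * ϱ₀) ≤ δN)
  -- cap piece
  (heF₃ : eF₃ ∈ IsManifold.maximalAtlas (𝓡 2) ∞ F) (heF₃t : eF₃.target = univ)
  (hA₃ : ∀ p, A₃ p = cx (eF₃ p))
  (hP₃T : ∀ p, p ∈ eF₃.source → ∀ v : EuclideanSpace ℝ (Fin 2),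
    T (p, v) ∈ P₃.source ∧ toC2 (P₃ (T (p, v))) = (A₃ p, (c : ℂ) * cx v))
  (hC1 : ContDiffOn ℝ ∞ C {p : ℂ × ℂ | ‖p.1‖ < 3 / 4 ∧ ‖p.2‖ < 1 / 2})
  (hC4 : ∀ a ν : ℂ, 2 / 3 ≤ ‖a‖ → C (a, ν) = (ν, conj (((‖a‖⁻¹ : ℝ) : ℂ) * a) *
      (Real.sqrt (1 + ‖ν‖ ^ 2) / (1 - ‖a‖ * Real.sqrt (1 + ‖ν‖ ^ 2)) : ℝ)))
  (hC6 : InjOn C {p : ℂ × ℂ | ‖p.1‖ < 3 / 4 ∧ ‖p.2‖ < 1 / 2})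
  (hC7 : ∀ p : ℂ × ℂ, ‖p.1‖ < 3 / 4 → ‖p.2‖ < 1 / 2 →
      ∃ L : (ℂ × ℂ) ≃L[ℝ] (ℂ × ℂ), HasStrictFDerivAt C (L : ℂ × ℂ →L[ℝ] ℂ × ℂ) p)
  (hk₃ : 0 < k₃) (hρC : k₃ * ρ₀ ≤ 1 / 2)
  (hCk : ∀ (p : F) (w : EuclideanSpace ℝ (Fin 2)), Ck (p, w) =
    (affineChart (n := 2) 0 : OpenPartialHomeomorph ComplexProjectivePlane
      (EuclideanSpace ℝ (Fin 4))).symm (fromC2 (C (A₃ p, ((k₃ : ℝ) : ℂ) * cx w))))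
  (hUC : UC = {p | p ∈ eF₃.source ∧ ‖A₃ p‖ < 3 / 4})
  (hCA : ∀ q : F × EuclideanSpace ℝ (Fin 2), Ck q ∈ AP)
  (hΨC : ∀ p ∈ eF₃.source, ‖A₃ p‖ < 4 / 5 → Ψ p = ((k₃ / c : ℝ) : ℂ) * A₃ p)
  (hDe₁ : D.e₁ = P₃)
  (hDe₂ : D.e₂ = (affineChart (n := 2) 2 : OpenPartialHomeomorph ComplexProjectivePlane (EuclideanSpace ℝ (Fin 4))))
  (hglue : ∀ x ∈ D.Φ.source, jX x = jP (D.Φ x))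
  (hx₃ : x₃ ∈ eF₃.source ∧ A₃ x₃ = 0)
  -- zone relations
  (hNC : ∀ p ∈ UN, p ∉ UC)
  (hFN : ∀ p ∈ UF, p ∈ UN → 3 / 4 ≤ ‖A p‖)
  (hFC : ∀ p ∈ UF, p ∈ UC → 2 / 3 ≤ ‖A₃ p‖)
  (hcover : ∀ p, p ≠ x₂ → p ∈ UN ∨ p ∈ UC ∨ p ∈ UF)
  -- the patched map
  (hΦA : ∀ q, ΦA q = if q.1 ∈ UN then jX (Nk q) else if q.1 ∈ UC then jP (Ck q)
    else jX (T (q.1, Θ q)))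

/-! ### §1 Elementary consequences of the hypotheses -/

omit [ChartedSpace (EuclideanSpace ℝ (Fin 2)) F] in
include hcx hA hUN in
/-- The neck zone is open. [folklore] -/
theorem isOpen_UN : IsOpen UN := by
  rw [hUN]
  have hAc : ContinuousOn A eF.source := by
    have : A = cx ∘ eF := funext hA
    rw [this]; exact (NeckPiece.contMDiff_cx hcx).continuous.comp_continuousOn eF.continuousOn
  have h1 : IsOpen (eF.source ∩ A ⁻¹' ({0}ᶜ ∩ ball (0 : ℂ) 2)) :=
    hAc.isOpen_inter_preimage eF.open_source (isOpen_compl_singleton.inter isOpen_ball)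
  have heq : {p | p ∈ eF.source ∧ A p ≠ 0 ∧ ‖A p‖ < 2} = eF.source ∩ A ⁻¹' ({0}ᶜ ∩ ball (0 : ℂ) 2) := by
    ext p
    simp only [mem_setOf_eq, mem_inter_iff, mem_preimage, mem_compl_iff, mem_singleton_iff,
      mem_ball_zero_iff]
  rw [heq]; exact h1

omit [ChartedSpace (EuclideanSpace ℝ (Fin 2)) F] in
include hcx hA₃ hUC in
/-- The cap zone is open. [folklore] -/
theorem isOpen_UC : IsOpen UC := by
  rw [hUC]
  have hAc : ContinuousOn A₃ eF₃.source := by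
    have : A₃ = cx ∘ eF₃ := funext hA₃
    rw [this]; exact (NeckPiece.contMDiff_cx hcx).continuous.comp_continuousOn eF₃.continuousOn
  have h1 : IsOpen (eF₃.source ∩ A₃ ⁻¹' ball (0 : ℂ) (3 / 4)) :=
    hAc.isOpen_inter_preimage eF₃.open_source isOpen_ball
  have heq : {p | p ∈ eF₃.source ∧ ‖A₃ p‖ < 3 / 4} = eF₃.source ∩ A₃ ⁻¹' ball (0 : ℂ) (3 / 4) := by
    ext p
    simp only [mem_setOf_eq, mem_inter_iff, mem_preimage, mem_ball_zero_iff]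
  rw [heq]; exact h1

omit [ChartedSpace (EuclideanSpace ℝ (Fin 2)) F] in
include hUN hx₂ in
/-- The neck zone misses `x₂`. [folklore] -/
theorem ne_x₂_of_mem_UN {p : F} (hp : p ∈ UN) : p ≠ x₂ := by
  rw [hUN] at hp
  rintro rfl
  exact hp.2.1 hx₂.2

/-- Numerical fact for the cap overlap: `‖a‖ < 3/4` and `‖ν‖ ≤ 1/2` give `‖a‖ √(1 + ‖ν‖²) < 1`.
[folklore] -/
theorem norm_mul_sqrt_lt_one {a ν : ℂ} (ha : ‖a‖ < 3 / 4) (hν : ‖ν‖ ≤ 1 / 2) :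
    ‖a‖ * Real.sqrt (1 + ‖ν‖ ^ 2) < 1 := by
  have hs : Real.sqrt (1 + ‖ν‖ ^ 2) ≤ 5 / 4 := by
    rw [Real.sqrt_le_left (by norm_num)]
    nlinarith [norm_nonneg ν]
  have hs0 : 0 ≤ Real.sqrt (1 + ‖ν‖ ^ 2) := Real.sqrt_nonneg _
  nlinarith [norm_nonneg a]

omit [TopologicalSpace F] [ChartedSpace (EuclideanSpace ℝ (Fin 2)) F] in
include hcx hk₃ hρC in
/-- The cap fibre coordinate `ν = k₃ cx ṽ` has `‖ν‖ < 1/2` on the fibre ball… `≤`, and `<` when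
`‖ṽ‖ < ρ₀`. [folklore] -/
theorem norm_capFibre_lt {w : EuclideanSpace ℝ (Fin 2)} (hw : ‖w‖ < ρ₀) :
    ‖((k₃ : ℝ) : ℂ) * cx w‖ < 1 / 2 := by
  rw [norm_mul, Complex.norm_real, Real.norm_eq_abs, abs_of_pos hk₃, NeckPiece.norm_cx hcx]
  calc k₃ * ‖w‖ < k₃ * ρ₀ := mul_lt_mul_of_pos_left hw hk₃
    _ ≤ 1 / 2 := hρC

omit [TopologicalSpace F] [ChartedSpace (EuclideanSpace ℝ (Fin 2)) F] in
include hc hϱ₀ hk hρN in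
/-- The neck fibre ball: `‖ṽ‖ < ρ₀` implies `‖ṽ‖ < δN / k`. [folklore] -/
theorem norm_lt_neckRadius {w : EuclideanSpace ℝ (Fin 2)} (hw : ‖w‖ < ρ₀) : ‖w‖ < δN / k := by
  have hk0 : 0 < k := by rw [hk]; exact mul_pos hc hϱ₀
  rw [lt_div_iff₀ hk0]
  calc ‖w‖ * k < ρ₀ * k := mul_lt_mul_of_pos_right hw hk0
    _ = ρ₀ * (c * ϱ₀) := by rw [hk]
    _ ≤ δN := hρN

/-! ### §2 The agreements on the overlaps -/

omit [ChartedSpace (EuclideanSpace ℝ (Fin 2)) F] [ChartedSpace (EuclideanSpace ℝ (Fin 4)) X]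
  [TopologicalSpace Z] [ChartedSpace (EuclideanSpace ℝ (Fin 4)) Z] in
include hcx hvc hc hPT hN2 hk hNk hUN hΨN hΘ hϱ₀ hFN in
/-- **Neck/far agreement**: on `U_N ∩ U_F` the neck formula is the far formula.
[cite: AkhmedovPark2010, §3] -/
theorem neck_agrees {q : F × EuclideanSpace ℝ (Fin 2)} (hqN : q.1 ∈ UN) (hqF : q.1 ∈ UF) :
    jX (Nk q) = jX (T (q.1, Θ q)) := by
  have h34 := hFN q.1 hqF hqN
  rw [hUN] at hqN
  obtain ⟨hp, hA0, hA2⟩ := hqN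
  have hk0 : 0 < k := by rw [hk]; exact mul_pos hc hϱ₀
  have h := TubeZones.neck_eq_far (hcx := hcx) (hvc := hvc) (hc := hc) (hPT := hPT) (hN2 := hN2)
    (hk := hk0) (hNk := hNk) hp h34 (hΨN q.1 hp hA0 hA2) q.2
  have hone : c * ϱ₀ / k = 1 := by rw [hk, div_self (mul_pos hc hϱ₀).ne']
  rw [hone, one_smul] at h
  rw [hΘ]
  exact congrArg jX h

omit [ChartedSpace (EuclideanSpace ℝ (Fin 2)) F] [TopologicalSpace Z]
  [ChartedSpace (EuclideanSpace ℝ (Fin 4)) Z] in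
include hcx hvc hc hP₃T hC4 hDe₁ hDe₂ hglue hUC hΨC hΘ hCk hk₃ hρC hFC in
/-- **Cap/far agreement**: on `U_C ∩ U_F` (where `2/3 ≤ ‖a₃‖ < 3/4`) and for `‖ṽ‖ < ρ₀` the cap
formula is the far formula. [cite: AkhmedovPark2010, §3] -/
theorem cap_agrees {q : F × EuclideanSpace ℝ (Fin 2)} (hqC : q.1 ∈ UC) (hqF : q.1 ∈ UF)
    (hw : ‖q.2‖ < ρ₀) : jP (Ck q) = jX (T (q.1, Θ q)) := by
  have h23 := hFC q.1 hqF hqC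
  rw [hUC] at hqC
  obtain ⟨hp, hA34⟩ := hqC
  have hν := norm_capFibre_lt hcx hk₃ hρC hw
  have hlt : ‖A₃ q.1‖ * Real.sqrt (1 + ‖((k₃ : ℝ) : ℂ) * cx q.2‖ ^ 2) < 1 :=
    norm_mul_sqrt_lt_one hA34 hν.le
  obtain ⟨-, -, h⟩ := TubeZones.cap_eq_far (hcx := hcx) (hvc := hvc) (hPT := hP₃T) (hC4 := hC4)
    (hDe₁ := hDe₁) (hDe₂ := hDe₂) (hglue := hglue) hc.ne' hp h23 q.2 hlt
    (hΨC q.1 hp (by linarith))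
  rw [hCk, hΘ]
  exact h

omit [ChartedSpace (EuclideanSpace ℝ (Fin 2)) F] [TopologicalSpace Z]
  [ChartedSpace (EuclideanSpace ℝ (Fin 4)) Z] in
include hcx hvc hc hPT hN2 hk hNk hUN hΨN hΘ hϱ₀ hFN hP₃T hC4 hDe₁ hDe₂ hglue hUC hΨC hCk hk₃ hρC hFC
  hNC hΦA in
/-- **`ΦA` equals each formula on its whole zone** (`U_N × B`, `U_C × B`, `U_F × B`, `B = B(0, ρ₀)`).
[cite: LeeSmoothManifolds2013, Cor. 2.8] -/
theorem sheetOne_eqOn :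
    (∀ q ∈ UN ×ˢ ball (0 : EuclideanSpace ℝ (Fin 2)) ρ₀, ΦA q = jX (Nk q)) ∧
    (∀ q ∈ UC ×ˢ ball (0 : EuclideanSpace ℝ (Fin 2)) ρ₀, ΦA q = jP (Ck q)) ∧
    (∀ q ∈ UF ×ˢ ball (0 : EuclideanSpace ℝ (Fin 2)) ρ₀, ΦA q = jX (T (q.1, Θ q))) := by
  refine ⟨fun q hq => by rw [hΦA, if_pos hq.1], fun q hq => ?_, fun q hq => ?_⟩
  · rw [hΦA, if_neg (fun h => hNC q.1 h hq.1), if_pos hq.1]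
  · rw [hΦA]
    by_cases h1 : q.1 ∈ UN
    · rw [if_pos h1]
      exact neck_agrees hcx hvc hΘ hϱ₀ hc hPT hN2 hk hNk hUN hΨN hFN h1 hq.1
    · rw [if_neg h1]
      by_cases h2 : q.1 ∈ UC
      · rw [if_pos h2]
        exact cap_agrees hcx hvc hΘ hc hP₃T hC4 hk₃ hρC hCk hUC hΨC hDe₁ hDe₂ hglue hFC h2 hq.1
          (mem_ball_zero_iff.1 hq.2)
      · rw [if_neg h2]

/-! ### §3 The three pieces: smoothness, injectivity, open images, left inverses -/

include hcx hvc hjX hjXi hjXo hT hTo hΨs hΨ0 hΘ hUF hUF₂ hFA in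
/-- **The far piece** `q ↦ jX (T (q.1, Θ q))` on `U_F × ℝ²`: smooth, injective, open on open
subsets, with a smooth left inverse on its image. [cite: LeeSmoothManifolds2013, Prop. 5.2] -/
theorem sheetOne_far_piece [Nonempty F] {jXinv : Z → X}
    (hjXinv : ContMDiffOn (𝓡 4) (𝓡 4) ∞ jXinv (jX '' AX)) (hjXinvl : ∀ x ∈ AX, jXinv (jX x) = x) :
    ContMDiffOn ((𝓡 2).prod (𝓡 2)) (𝓡 4) ∞ (fun q : F × EuclideanSpace ℝ (Fin 2) => jX (T (q.1, Θ q)))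
        (UF ×ˢ (univ : Set (EuclideanSpace ℝ (Fin 2)))) ∧
      InjOn (fun q : F × EuclideanSpace ℝ (Fin 2) => jX (T (q.1, Θ q)))
        (UF ×ˢ (univ : Set (EuclideanSpace ℝ (Fin 2)))) ∧
      (∀ O, IsOpen O → O ⊆ UF ×ˢ (univ : Set (EuclideanSpace ℝ (Fin 2))) →
        IsOpen ((fun q : F × EuclideanSpace ℝ (Fin 2) => jX (T (q.1, Θ q))) '' O)) ∧
      ∃ r : Z → F × EuclideanSpace ℝ (Fin 2),
        ContMDiffOn (𝓡 4) ((𝓡 2).prod (𝓡 2)) ∞ r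
          ((fun q : F × EuclideanSpace ℝ (Fin 2) => jX (T (q.1, Θ q))) ''
            (UF ×ˢ (univ : Set (EuclideanSpace ℝ (Fin 2))))) ∧
        ∀ q ∈ UF ×ˢ (univ : Set (EuclideanSpace ℝ (Fin 2))),
          r (jX (T (q.1, Θ q))) = q := by
  -- the multiplier is smooth and nonvanishing on `U_F`
  have hm : ContMDiffOn (𝓡 2) 𝓘(ℝ, ℂ) ∞ Ψ UF := hΨs.mono fun p hp => (hUF₂ p hp).1
  have hm0 : ∀ p ∈ UF, Ψ p ≠ 0 := fun p hp => hΨ0 p (hUF₂ p hp).1 (hUF₂ p hp).2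
  obtain ⟨Λ, hΛ⟩ : ∃ Λ : F × EuclideanSpace ℝ (Fin 2) → EuclideanSpace ℝ (Fin 2),
      ∀ q, Λ q = vc ((Ψ q.1)⁻¹ * cx q.2) := ⟨_, fun _ => rfl⟩
  have hfar := FibreProfile.contMDiffOn_linearFar hcx hvc hT hm hΘ
  have hinj := FibreProfile.injOn_linearFar hcx hvc hT hm0 hΘ hΛ
  have hopen := fun {Oq} (hOq : IsOpen Oq) (hOqW : Oq ⊆ UF ×ˢ (univ : Set _)) =>
    FibreProfile.isOpen_image_linearFar hcx hvc hT hTo hUF hm hm0 hΘ hΛ hOq hOqW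
  obtain ⟨Rinv, hRinv, hRinvl⟩ := FibreProfile.exists_inverse_linearFar hcx hvc hT hm hm0 hΘ hΛ
  have hmemA : ∀ q ∈ UF ×ˢ (univ : Set (EuclideanSpace ℝ (Fin 2))), T (q.1, Θ q) ∈ AX :=
    fun q hq => hFA q.1 hq.1 q.2
  have himg : (fun q : F × EuclideanSpace ℝ (Fin 2) => T (q.1, Θ q)) ''
      (UF ×ˢ (univ : Set (EuclideanSpace ℝ (Fin 2)))) ⊆ AX := by
    rintro _ ⟨q, hq, rfl⟩; exact hmemA q hq
  refine ⟨?_, ?_, ?_, ?_⟩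
  · exact hjX.comp hfar hmemA
  · intro q hq q' hq' h
    exact hinj hq hq' (hjXi (hmemA q hq) (hmemA q' hq') h)
  · intro O hO hOW
    rw [show (fun q : F × EuclideanSpace ℝ (Fin 2) => jX (T (q.1, Θ q))) =
      jX ∘ (fun q : F × EuclideanSpace ℝ (Fin 2) => T (q.1, Θ q)) from rfl, image_comp]
    exact hjXo _ (hopen hO hOW) ((image_mono hOW).trans himg)
  · refine ⟨Rinv ∘ jXinv, ?_, fun q hq => ?_⟩
    · rw [show (fun q : F × EuclideanSpace ℝ (Fin 2) => jX (T (q.1, Θ q))) =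
        jX ∘ (fun q : F × EuclideanSpace ℝ (Fin 2) => T (q.1, Θ q)) from rfl, image_comp]
      refine hRinv.comp (hjXinv.mono (image_mono himg)) ?_
      rintro _ ⟨x, hx, rfl⟩
      rw [mem_preimage, hjXinvl x (himg hx)]; exact hx
    · show Rinv (jXinv (jX (T (q.1, Θ q)))) = q
      rw [hjXinvl _ (hmemA q hq), hRinvl q hq]

include hcx hvc hjX hjXi hjXo heF heFt hA hP hPt hc hϱ₀ hN1 hN4 hN5 hk hNk hUN hNA hρN in
/-- **The neck piece** `q ↦ jX (Nk q)` on `U_N × B(0, ρ₀)`: smooth, injective, open on open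
subsets, with a smooth left inverse on its image. [cite: AkhmedovPark2010, §3] -/
theorem sheetOne_neck_piece {jXinv : Z → X}
    (hjXinv : ContMDiffOn (𝓡 4) (𝓡 4) ∞ jXinv (jX '' AX)) (hjXinvl : ∀ x ∈ AX, jXinv (jX x) = x) :
    ContMDiffOn ((𝓡 2).prod (𝓡 2)) (𝓡 4) ∞ (fun q : F × EuclideanSpace ℝ (Fin 2) => jX (Nk q))
        (UN ×ˢ ball (0 : EuclideanSpace ℝ (Fin 2)) ρ₀) ∧
      InjOn (fun q : F × EuclideanSpace ℝ (Fin 2) => jX (Nk q))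
        (UN ×ˢ ball (0 : EuclideanSpace ℝ (Fin 2)) ρ₀) ∧
      (∀ O, IsOpen O → O ⊆ UN ×ˢ ball (0 : EuclideanSpace ℝ (Fin 2)) ρ₀ →
        IsOpen ((fun q : F × EuclideanSpace ℝ (Fin 2) => jX (Nk q)) '' O)) ∧
      ∃ r : Z → F × EuclideanSpace ℝ (Fin 2),
        ContMDiffOn (𝓡 4) ((𝓡 2).prod (𝓡 2)) ∞ r
          ((fun q : F × EuclideanSpace ℝ (Fin 2) => jX (Nk q)) ''
            (UN ×ˢ ball (0 : EuclideanSpace ℝ (Fin 2)) ρ₀)) ∧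
        ∀ q ∈ UN ×ˢ ball (0 : EuclideanSpace ℝ (Fin 2)) ρ₀, r (jX (Nk q)) = q := by
  have hk0 : 0 < k := by rw [hk]; exact mul_pos hc hϱ₀
  -- the zone is inside the neck piece's domain `Ω × B(0, δ/k)`
  have hsub : UN ×ˢ ball (0 : EuclideanSpace ℝ (Fin 2)) ρ₀ ⊆
      {p | p ∈ eF.source ∧ A p ≠ 0} ×ˢ ball (0 : EuclideanSpace ℝ (Fin 2)) (δN / k) := by
    rintro ⟨p, w⟩ ⟨hp, hw⟩
    rw [hUN] at hp
    exact ⟨⟨hp.1, hp.2.1⟩, mem_ball_zero_iff.2 (norm_lt_neckRadius (hc := hc) (hϱ₀ := hϱ₀) (hk := hk) (hρN := hρN) (mem_ball_zero_iff.1 hw))⟩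
  have hsub' : UN ×ˢ ball (0 : EuclideanSpace ℝ (Fin 2)) ρ₀ ⊆
      {p | p ∈ eF.source ∧ A p ≠ 0} ×ˢ (univ : Set (EuclideanSpace ℝ (Fin 2))) :=
    fun q hq => ⟨(hsub hq).1, mem_univ _⟩
  have hsm := NeckPiece.contMDiffOn_neckPiece (hcx := hcx) (heF := heF) (hA := hA) (hP := hP)
    (hPt := hPt) (hN1 := hN1) (hNk := hNk)
  have hinj := NeckPiece.injOn_neckPiece (hcx := hcx) (hA := hA) (hPt := hPt) (hN4 := hN4) (hk := hk0)
    (hNk := hNk) (δ := δN)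
  have hopen := fun {W} (hWo : IsOpen W) hW => NeckPiece.isOpen_image_neckPiece (hcx := hcx) (hvc := hvc)
    (hA := hA) (hPt := hPt) (hN5 := hN5) (hk := hk0) (hNk := hNk) (δ := δN) hWo hW
  obtain ⟨Ninv, hNinv, hNinvl⟩ := NeckPiece.exists_inverse_neckPiece (hcx := hcx) (hvc := hvc)
    (heF := heF) (heFt := heFt) (hA := hA) (hP := hP) (hPt := hPt) (hN1 := hN1) (hN4 := hN4)
    (hN5 := hN5) (hk := hk0) (hNk := hNk) (δ := δN)
  have hmemA : ∀ q ∈ UN ×ˢ ball (0 : EuclideanSpace ℝ (Fin 2)) ρ₀, Nk q ∈ AX := fun q hq =>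
    hNA q.1 (hsub hq).1.1 (hsub hq).1.2 q.2
  have himg : Nk '' (UN ×ˢ ball (0 : EuclideanSpace ℝ (Fin 2)) ρ₀) ⊆ AX := by
    rintro _ ⟨q, hq, rfl⟩; exact hmemA q hq
  refine ⟨?_, ?_, ?_, ?_⟩
  · exact hjX.comp (hsm.mono hsub') hmemA
  · intro q hq q' hq' h
    exact hinj (hsub hq) (hsub hq') (hjXi (hmemA q hq) (hmemA q' hq') h)
  · intro O hO hOW
    rw [show (fun q : F × EuclideanSpace ℝ (Fin 2) => jX (Nk q)) = jX ∘ Nk from rfl, image_comp]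
    exact hjXo _ (hopen hO (hOW.trans hsub)) ((image_mono hOW).trans himg)
  · refine ⟨Ninv ∘ jXinv, ?_, fun q hq => ?_⟩
    · rw [show (fun q : F × EuclideanSpace ℝ (Fin 2) => jX (Nk q)) = jX ∘ Nk from rfl, image_comp]
      refine (hNinv.mono (image_mono hsub)).comp (hjXinv.mono (image_mono himg)) ?_
      rintro _ ⟨x, hx, rfl⟩
      rw [mem_preimage, hjXinvl x (himg hx)]; exact hx
    · show Ninv (jXinv (jX (Nk q))) = q
      rw [hjXinvl _ (hmemA q hq), hNinvl q (hsub hq)]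

include hcx hjP hjPi hjPo heF₃ heF₃t hA₃ hC1 hC6 hC7 hk₃ hρC hCk hUC hCA in
/-- **The cap piece** `q ↦ jP (Ck q)` on `U_C × B(0, ρ₀)`: smooth, injective, open on open
subsets, with a smooth left inverse on its image. [cite: AkhmedovPark2010, §3] -/
theorem sheetOne_cap_piece {jPinv : Z → ComplexProjectivePlane}
    (hjPinv : ContMDiffOn (𝓡 4) (𝓡 4) ∞ jPinv (jP '' AP)) (hjPinvl : ∀ y ∈ AP, jPinv (jP y) = y) :
    ContMDiffOn ((𝓡 2).prod (𝓡 2)) (𝓡 4) ∞ (fun q : F × EuclideanSpace ℝ (Fin 2) => jP (Ck q))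
        (UC ×ˢ ball (0 : EuclideanSpace ℝ (Fin 2)) ρ₀) ∧
      InjOn (fun q : F × EuclideanSpace ℝ (Fin 2) => jP (Ck q))
        (UC ×ˢ ball (0 : EuclideanSpace ℝ (Fin 2)) ρ₀) ∧
      (∀ O, IsOpen O → O ⊆ UC ×ˢ ball (0 : EuclideanSpace ℝ (Fin 2)) ρ₀ →
        IsOpen ((fun q : F × EuclideanSpace ℝ (Fin 2) => jP (Ck q)) '' O)) ∧
      ∃ r : Z → F × EuclideanSpace ℝ (Fin 2),
        ContMDiffOn (𝓡 4) ((𝓡 2).prod (𝓡 2)) ∞ r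
          ((fun q : F × EuclideanSpace ℝ (Fin 2) => jP (Ck q)) ''
            (UC ×ˢ ball (0 : EuclideanSpace ℝ (Fin 2)) ρ₀)) ∧
        ∀ q ∈ UC ×ˢ ball (0 : EuclideanSpace ℝ (Fin 2)) ρ₀, r (jP (Ck q)) = q := by
  -- `ModelPiece` data: chart `affineChart 0` (full target), model `C` on `U = {‖a‖<3/4, ‖ν‖<1/2}`
  have hA' : ∀ p, A₃ p = ⟨eF₃ p 0, eF₃ p 1⟩ := fun p => by rw [hA₃, hcx]
  have hQ := ToricBlowup.affineChart_mem_maximalAtlas (0 : Fin 3)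
  have hQt : (affineChart (n := 2) 0 : OpenPartialHomeomorph ComplexProjectivePlane
      (EuclideanSpace ℝ (Fin 4))).target = univ := affineChart_target 0
  have hU : IsOpen {p : ℂ × ℂ | ‖p.1‖ < 3 / 4 ∧ ‖p.2‖ < 1 / 2} :=
    (isOpen_lt (continuous_norm.comp continuous_fst) continuous_const).inter
      (isOpen_lt (continuous_norm.comp continuous_snd) continuous_const)
  have hMk : ∀ (p : F) (w : EuclideanSpace ℝ (Fin 2)), Ck (p, w) =
      (affineChart (n := 2) 0 : OpenPartialHomeomorph ComplexProjectivePlane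
        (EuclideanSpace ℝ (Fin 4))).symm (fromC2 (C (A₃ p, (k₃ : ℂ) * ⟨w 0, w 1⟩))) := fun p w => by
    rw [hCk, hcx]
  have hM5 : ∀ q ∈ {p : ℂ × ℂ | ‖p.1‖ < 3 / 4 ∧ ‖p.2‖ < 1 / 2},
      ∃ L : (ℂ × ℂ) ≃L[ℝ] (ℂ × ℂ), HasStrictFDerivAt C (L : ℂ × ℂ →L[ℝ] ℂ × ℂ) q :=
    fun q hq => hC7 q hq.1 hq.2
  -- the zone is inside the model piece's domain
  have hsub : UC ×ˢ ball (0 : EuclideanSpace ℝ (Fin 2)) ρ₀ ⊆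
      {q : F × EuclideanSpace ℝ (Fin 2) | q.1 ∈ eF₃.source ∧
        (A₃ q.1, (k₃ : ℂ) * ⟨q.2 0, q.2 1⟩) ∈ {p : ℂ × ℂ | ‖p.1‖ < 3 / 4 ∧ ‖p.2‖ < 1 / 2}} := by
    rintro ⟨p, w⟩ ⟨hp, hw⟩
    rw [hUC] at hp
    refine ⟨hp.1, hp.2, ?_⟩
    have := norm_capFibre_lt hcx hk₃ hρC (mem_ball_zero_iff.1 hw)
    rwa [hcx] at this
  have hsm := ModelPiece.contMDiffOn_modelPiece (heF := heF₃) (hA := hA') (hQ := hQ) (hQt := hQt)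
    (hM1 := hC1) (hMk := hMk)
  have hinj := ModelPiece.injOn_modelPiece (hA := hA') (hQt := hQt) (hM4 := hC6) (hk := hk₃) (hMk := hMk)
  have hopen := fun {W} (hWo : IsOpen W) hW => ModelPiece.isOpen_image_modelPiece (hA := hA') (hQt := hQt)
    (hM5 := hM5) (hk := hk₃) (hMk := hMk) hWo hW
  obtain ⟨Minv, hMinv, hMinvl⟩ := ModelPiece.exists_inverse_modelPiece (heF := heF₃) (heFt := heF₃t)
    (hA := hA') (hQ := hQ) (hQt := hQt) (hU := hU) (hM1 := hC1) (hM4 := hC6) (hM5 := hM5) (hk := hk₃)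
    (hMk := hMk)
  have hmemA : ∀ q ∈ UC ×ˢ ball (0 : EuclideanSpace ℝ (Fin 2)) ρ₀, Ck q ∈ AP := fun q _ => hCA q
  have himg : Ck '' (UC ×ˢ ball (0 : EuclideanSpace ℝ (Fin 2)) ρ₀) ⊆ AP := by
    rintro _ ⟨q, hq, rfl⟩; exact hmemA q hq
  refine ⟨?_, ?_, ?_, ?_⟩
  · exact hjP.comp (hsm.mono hsub) hmemA
  · intro q hq q' hq' h
    exact hinj (hsub hq) (hsub hq') (hjPi (hmemA q hq) (hmemA q' hq') h)
  · intro O hO hOW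
    rw [show (fun q : F × EuclideanSpace ℝ (Fin 2) => jP (Ck q)) = jP ∘ Ck from rfl, image_comp]
    exact hjPo _ (hopen hO (hOW.trans hsub)) ((image_mono hOW).trans himg)
  · refine ⟨Minv ∘ jPinv, ?_, fun q hq => ?_⟩
    · rw [show (fun q : F × EuclideanSpace ℝ (Fin 2) => jP (Ck q)) = jP ∘ Ck from rfl, image_comp]
      refine (hMinv.mono (image_mono hsub)).comp (hjPinv.mono (image_mono himg)) ?_
      rintro _ ⟨x, hx, rfl⟩
      rw [mem_preimage, hjPinvl x (himg hx)]; exact hx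
    · show Minv (jPinv (jP (Ck q))) = q
      rw [hjPinvl _ (hmemA q hq), hMinvl q (hsub hq)]

/-! ### §4 Smoothness of the first sheet -/

include hcx hvc hjX hjXi hjXo hjP hjPi hjPo hT hTo hΨs hΨ0 hΘ hUF hUF₂ hFA hϱ₀ heF heFt hA hP hPt hc
  hPT hN1 hN2 hN4 hN5 hk hNk hUN hNA hΨN hρN heF₃ heF₃t hA₃ hP₃T hC1 hC4 hC6 hC7 hk₃ hρC hCk hUC
  hCA hΨC hDe₁ hDe₂ hglue hNC hFN hFC hcover hΦA in
/-- **The first sheet of the tube is smooth on `(T ∖ {x₂}) × B(0, ρ₀)`.**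
[cite: AkhmedovPark2010, §3] [cite: LeeSmoothManifolds2013, Cor. 2.8] -/
theorem contMDiffOn_sheetOne [Nonempty F] {jXinv : Z → X}
    (hjXinv : ContMDiffOn (𝓡 4) (𝓡 4) ∞ jXinv (jX '' AX)) (hjXinvl : ∀ x ∈ AX, jXinv (jX x) = x)
    {jPinv : Z → ComplexProjectivePlane}
    (hjPinv : ContMDiffOn (𝓡 4) (𝓡 4) ∞ jPinv (jP '' AP)) (hjPinvl : ∀ y ∈ AP, jPinv (jP y) = y) :
    ContMDiffOn ((𝓡 2).prod (𝓡 2)) (𝓡 4) ∞ ΦA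
      ({p | p ≠ x₂} ×ˢ ball (0 : EuclideanSpace ℝ (Fin 2)) ρ₀) := by
  obtain ⟨h1, h2, h3⟩ := sheetOne_eqOn hcx hvc hΘ hϱ₀ hc hPT hN2 hk hNk hUN hΨN hP₃T hC4 hk₃ hρC hCk
    hUC hΨC hDe₁ hDe₂ hglue hNC hFN hFC hΦA
  obtain ⟨hsF, -, -, -⟩ := sheetOne_far_piece hcx hvc hjX hjXi hjXo hT hTo hΨs hΨ0 hΘ hUF hUF₂ hFA
    hjXinv hjXinvl
  obtain ⟨hsN, -, -, -⟩ := sheetOne_neck_piece hcx hvc hjX hjXi hjXo hϱ₀ heF heFt hA hP hPt hc hN1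
    hN4 hN5 hk hNk hUN hNA hρN hjXinv hjXinvl
  obtain ⟨hsC, -, -, -⟩ := sheetOne_cap_piece hcx hjP hjPi hjPo heF₃ heF₃t hA₃ hC1 hC6 hC7 hk₃
    hρC hCk hUC hCA hjPinv hjPinvl
  have hoB : IsOpen (ball (0 : EuclideanSpace ℝ (Fin 2)) ρ₀) := isOpen_ball
  refine Patching.contMDiffOn_of_three (U₁ := UN ×ˢ ball (0 : EuclideanSpace ℝ (Fin 2)) ρ₀)
    (U₂ := UC ×ˢ ball (0 : EuclideanSpace ℝ (Fin 2)) ρ₀)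
    (U₃ := UF ×ˢ ball (0 : EuclideanSpace ℝ (Fin 2)) ρ₀) ?_
    ((isOpen_UN hcx hA hUN).prod hoB) ((isOpen_UC hcx hA₃ hUC).prod hoB) (hUF.prod hoB)
    h1 h2 h3 hsN hsC (hsF.mono (prod_mono le_rfl (subset_univ _)))
  rintro ⟨p, w⟩ ⟨hp, hw⟩
  rcases hcover p hp with h | h | h
  · exact Or.inl (Or.inl ⟨h, hw⟩)
  · exact Or.inl (Or.inr ⟨h, hw⟩)
  · exact Or.inr ⟨h, hw⟩

/-! ### §5 Injectivity of the first sheet -/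

omit [TopologicalSpace F] [ChartedSpace (EuclideanSpace ℝ (Fin 2)) F] in
/-- **The second cap coordinate dominates**: for `‖a′‖ < 2/3 ≤ ‖a‖`, `‖a‖ s < 1`
(`s = √(1 + ‖ν‖²)`, `‖ν‖ < 1/2`), `‖(C (a′, ν)).2‖ < s / (1 - ‖a‖ s)` — the last clause of
`exists_blowUpCapTube`, extended from `‖a‖ < 4/5` to all `‖a‖` with `‖a‖ s < 1` by monotonicity
in `‖a‖`. [cite: AkhmedovPark2010, §3] -/
theorem cap_second_lt
    (hC8 : ∀ a' a ν : ℂ, ‖a'‖ < 2 / 3 → 2 / 3 ≤ ‖a‖ → ‖a‖ < 4 / 5 → ‖ν‖ < 1 / 2 →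
      ‖(C (a', ν)).2‖ < Real.sqrt (1 + ‖ν‖ ^ 2) / (1 - ‖a‖ * Real.sqrt (1 + ‖ν‖ ^ 2)))
    {a' a ν : ℂ} (ha' : ‖a'‖ < 2 / 3) (ha : 2 / 3 ≤ ‖a‖)
    (hlt : ‖a‖ * Real.sqrt (1 + ‖ν‖ ^ 2) < 1) (hν : ‖ν‖ < 1 / 2) :
    ‖(C (a', ν)).2‖ < Real.sqrt (1 + ‖ν‖ ^ 2) / (1 - ‖a‖ * Real.sqrt (1 + ‖ν‖ ^ 2)) := by
  by_cases h45 : ‖a‖ < 4 / 5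
  · exact hC8 a' a ν ha' ha h45 hν
  · have h45 : 4 / 5 ≤ ‖a‖ := not_lt.1 h45
    have hs0 : 0 ≤ Real.sqrt (1 + ‖ν‖ ^ 2) := Real.sqrt_nonneg _
    have ha0 : 0 < ‖a‖ := by linarith
    -- the reference parameter of norm `7/10`
    have hna₀ : ‖(((7 / 10) * ‖a‖⁻¹ : ℝ) : ℂ) * a‖ = 7 / 10 := by
      rw [norm_mul, Complex.norm_real, Real.norm_eq_abs, abs_of_pos (by positivity),
        mul_assoc, inv_mul_cancel₀ ha0.ne', mul_one]
    have h := hC8 a' ((((7 / 10) * ‖a‖⁻¹ : ℝ) : ℂ) * a) ν ha' (by rw [hna₀]; norm_num)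
      (by rw [hna₀]; norm_num) hν
    rw [hna₀] at h
    refine lt_of_lt_of_le h ?_
    have hpos : 0 < 1 - ‖a‖ * Real.sqrt (1 + ‖ν‖ ^ 2) := by linarith
    exact div_le_div_of_nonneg_left hs0 hpos (by nlinarith)

/-- The norm of the far-zone cap coordinate `conj â · s/(1 - ‖a‖ s)` is `s/(1 - ‖a‖ s)`. [folklore] -/
theorem norm_farCapCoord {a ν : ℂ} (ha : a ≠ 0) (hlt : ‖a‖ * Real.sqrt (1 + ‖ν‖ ^ 2) < 1) :
    ‖conj (((‖a‖⁻¹ : ℝ) : ℂ) * a) *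
        ((Real.sqrt (1 + ‖ν‖ ^ 2) / (1 - ‖a‖ * Real.sqrt (1 + ‖ν‖ ^ 2)) : ℝ) : ℂ)‖ =
      Real.sqrt (1 + ‖ν‖ ^ 2) / (1 - ‖a‖ * Real.sqrt (1 + ‖ν‖ ^ 2)) := by
  obtain ⟨-, hu⟩ := TubeZones.norm_unit ha
  have hpos : 0 < 1 - ‖a‖ * Real.sqrt (1 + ‖ν‖ ^ 2) := by linarith
  rw [norm_mul, hu, one_mul, Complex.norm_real, Real.norm_eq_abs,
    abs_of_nonneg (div_nonneg (Real.sqrt_nonneg _) hpos.le)]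

omit [ChartedSpace (EuclideanSpace ℝ (Fin 2)) F] [TopologicalSpace Z]
  [ChartedSpace (EuclideanSpace ℝ (Fin 4)) Z] in
include hcx hvc hc hPT hN2 hk hNk hUN hΨN hΘ hϱ₀ hP₃T hC4 hDe₁ hDe₂ hglue hUC hΨC hCk hk₃ hρC hFC hNC hΦA
  hFN hcover in
/-- **The far formula holds on the whole far REGION** `R_F = {p ≠ x₂} ∖ (R_N ∪ R_C)`,
`R_N = {0 < ‖a₂‖ < 1}`, `R_C = {‖a₃‖ < 2/3}` (on `U_N ∖ R_N` and `U_C ∖ R_C` the neck and cap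
formulas are the far formula). [cite: AkhmedovPark2010, §3] -/
theorem sheetOne_eq_far_of_region {q : F × EuclideanSpace ℝ (Fin 2)} (hq2 : q.1 ≠ x₂)
    (hqN : q.1 ∉ {p | p ∈ eF.source ∧ A p ≠ 0 ∧ ‖A p‖ < 1})
    (hqC : q.1 ∉ {p | p ∈ eF₃.source ∧ ‖A₃ p‖ < 2 / 3}) (hw : ‖q.2‖ < ρ₀) :
    ΦA q = jX (T (q.1, Θ q)) := by
  obtain ⟨h1, h2, h3⟩ := sheetOne_eqOn hcx hvc hΘ hϱ₀ hc hPT hN2 hk hNk hUN hΨN hP₃T hC4 hk₃ hρC hCk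
    hUC hΨC hDe₁ hDe₂ hglue hNC hFN hFC hΦA
  have hk0 : 0 < k := by rw [hk]; exact mul_pos hc hϱ₀
  rcases hcover q.1 hq2 with h | h | h
  · -- `q.1 ∈ U_N ∖ R_N`: `1 ≤ ‖A‖ < 2`
    rw [h1 q ⟨h, mem_ball_zero_iff.2 hw⟩]
    have h' := h
    rw [hUN] at h'
    obtain ⟨hp, hA0, hA2⟩ := h'
    have hA1 : 1 ≤ ‖A q.1‖ := by
      by_contra hlt; exact hqN ⟨hp, hA0, not_le.1 hlt⟩
    have hh := TubeZones.neck_eq_far (hcx := hcx) (hvc := hvc) (hc := hc) (hPT := hPT) (hN2 := hN2)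
      (hk := hk0) (hNk := hNk) hp (by linarith) (hΨN q.1 hp hA0 hA2) q.2
    have hone : c * ϱ₀ / k = 1 := by rw [hk, div_self (mul_pos hc hϱ₀).ne']
    rw [hone, one_smul] at hh
    rw [hΘ]; exact congrArg jX hh
  · -- `q.1 ∈ U_C ∖ R_C`: `2/3 ≤ ‖A₃‖ < 3/4`
    rw [h2 q ⟨h, mem_ball_zero_iff.2 hw⟩]
    have h' := h
    rw [hUC] at h'
    obtain ⟨hp, hA34⟩ := h'
    have hA23 : 2 / 3 ≤ ‖A₃ q.1‖ := by
      by_contra hlt; exact hqC ⟨hp, not_le.1 hlt⟩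
    have hν := norm_capFibre_lt hcx hk₃ hρC hw
    have hlt : ‖A₃ q.1‖ * Real.sqrt (1 + ‖((k₃ : ℝ) : ℂ) * cx q.2‖ ^ 2) < 1 :=
      norm_mul_sqrt_lt_one hA34 hν.le
    obtain ⟨-, -, hh⟩ := TubeZones.cap_eq_far (hcx := hcx) (hvc := hvc) (hPT := hP₃T) (hC4 := hC4)
      (hDe₁ := hDe₁) (hDe₂ := hDe₂) (hglue := hglue) hc.ne' hp hA23 q.2 hlt
      (hΨC q.1 hp (by linarith))
    rw [hCk, hΘ]; exact hh
  · exact h3 q ⟨h, mem_ball_zero_iff.2 hw⟩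

omit [ChartedSpace (EuclideanSpace ℝ (Fin 2)) F] [TopologicalSpace Z]
  [ChartedSpace (EuclideanSpace ℝ (Fin 4)) Z] in
include hcx hvc hc hPT hN2 hk hNk hUN hΨN hΘ hϱ₀ hP₃T hC4 hDe₁ hDe₂ hglue hUC hΨC hk₃ hρC hcover hNA hFA in
/-- The far point `T (p, Θ q)` of the far region lies in `AX` (in `U_N` it is a neck point, in
`U_C` a glued point, in `U_F` by hypothesis). [folklore] -/
theorem far_mem_AX_of_region (hAX : ∀ x ∈ D.Φ.source, x ∈ AX) {q : F × EuclideanSpace ℝ (Fin 2)}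
    (hq2 : q.1 ≠ x₂) (hqN : q.1 ∉ {p | p ∈ eF.source ∧ A p ≠ 0 ∧ ‖A p‖ < 1})
    (hqC : q.1 ∉ {p | p ∈ eF₃.source ∧ ‖A₃ p‖ < 2 / 3}) (hw : ‖q.2‖ < ρ₀) :
    T (q.1, Θ q) ∈ AX := by
  have hk0 : 0 < k := by rw [hk]; exact mul_pos hc hϱ₀
  rcases hcover q.1 hq2 with h | h | h
  · have h' := h; rw [hUN] at h'
    obtain ⟨hp, hA0, hA2⟩ := h'
    have hA1 : 1 ≤ ‖A q.1‖ := by by_contra hlt; exact hqN ⟨hp, hA0, not_le.1 hlt⟩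
    have hh := TubeZones.neck_eq_far (hcx := hcx) (hvc := hvc) (hc := hc) (hPT := hPT) (hN2 := hN2)
      (hk := hk0) (hNk := hNk) hp (by linarith) (hΨN q.1 hp hA0 hA2) q.2
    rw [hΘ, ← hh]; exact hNA q.1 hp hA0 _
  · have h' := h; rw [hUC] at h'
    obtain ⟨hp, hA34⟩ := h'
    have hA23 : 2 / 3 ≤ ‖A₃ q.1‖ := by by_contra hlt; exact hqC ⟨hp, not_le.1 hlt⟩
    have hν := norm_capFibre_lt hcx hk₃ hρC hw
    obtain ⟨hsrc, -, -⟩ := TubeZones.cap_eq_far (hcx := hcx) (hvc := hvc) (hPT := hP₃T) (hC4 := hC4)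
      (hDe₁ := hDe₁) (hDe₂ := hDe₂) (hglue := hglue) hc.ne' hp hA23 q.2
      (norm_mul_sqrt_lt_one hA34 hν.le) (hΨC q.1 hp (by linarith))
    rw [hΘ]; exact hAX _ hsrc
  · exact hFA q.1 h q.2

omit [TopologicalSpace Z] [ChartedSpace (EuclideanSpace ℝ (Fin 4)) Z] in
include hcx hvc hjXi hjPi hT hΨ0 hΘ hϱ₀ hA hPt hc hPT hN2 hN4 hN6 hk hNk hUN hNA hΨN hx₂ hρN hA₃
  hP₃T hC4 hC6 hk₃ hρC hCk hUC hCA hΨC hDe₁ hDe₂ hglue hx₃ hNC hFN hFC hcover hΦA hFA in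
/-- **The first sheet of the tube is injective on `(T ∖ {x₂}) × B(0, ρ₀)`.**  Regions: neck
`R_N × B` (neck piece injective), cap `R_C × B` (cap piece injective), far `R_F × B` (product tube
injective, multiplier nonvanishing); cross cases: a neck point is never glued (hypothesis `hNΦ`:
the neck lies off the blow-up ball) and has first plumbing coordinate of norm `< 1` while a far
point in the chart has `‖a₂‖ ≥ 1`; a cap point equals a far point only through the gluing, where
the second cap coordinate is too small (`cap_second_lt`). [cite: AkhmedovPark2010, §3] -/
theorem injOn_sheetOne
    (hXP : ∀ x ∈ AX, ∀ y ∈ AP, jX x = jP y → x ∈ D.Φ.source ∧ D.Φ x = y)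
    (hAX : ∀ x ∈ D.Φ.source, x ∈ AX)
    (hNΦ : ∀ p ∈ eF.source, A p ≠ 0 → ∀ w : EuclideanSpace ℝ (Fin 2), Nk (p, w) ∉ D.Φ.source)
    (hTP : ∀ (p : F) (v : EuclideanSpace ℝ (Fin 2)), T (p, v) ∈ P.source → p ∈ eF.source)
    (hTP₃ : ∀ (p : F) (v : EuclideanSpace ℝ (Fin 2)), T (p, v) ∈ P₃.source → p ∈ eF₃.source)
    (hC2 : ∀ a ν : ℂ, (C (a, ν)).1 = ν)
    (hC8 : ∀ a' a ν : ℂ, ‖a'‖ < 2 / 3 → 2 / 3 ≤ ‖a‖ → ‖a‖ < 4 / 5 → ‖ν‖ < 1 / 2 →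
      ‖(C (a', ν)).2‖ < Real.sqrt (1 + ‖ν‖ ^ 2) / (1 - ‖a‖ * Real.sqrt (1 + ‖ν‖ ^ 2))) :
    InjOn ΦA ({p | p ≠ x₂} ×ˢ ball (0 : EuclideanSpace ℝ (Fin 2)) ρ₀) := by
  have hk0 : 0 < k := by rw [hk]; exact mul_pos hc hϱ₀
  obtain ⟨h1, h2, -⟩ := sheetOne_eqOn hcx hvc hΘ hϱ₀ hc hPT hN2 hk hNk hUN hΨN hP₃T hC4 hk₃ hρC hCk
    hUC hΨC hDe₁ hDe₂ hglue hNC hFN hFC hΦA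
  -- `A` vanishes only at `x₂` on the chart domain
  have hAinj := NeckPiece.injOn_A (hcx := hcx) (hA := hA) (eF := eF)
  have hA0 : ∀ p ∈ eF.source, p ≠ x₂ → A p ≠ 0 := fun p hp hne h =>
    hne (hAinj hp hx₂.1 (by rw [h, hx₂.2]))
  have hx₃C : ∀ p, p ∉ {p | p ∈ eF₃.source ∧ ‖A₃ p‖ < 2 / 3} → p ≠ x₃ := fun p hp h =>
    hp (by rw [h]; exact ⟨hx₃.1, by rw [hx₃.2, norm_zero]; norm_num⟩)
  refine Patching.injOn_of_three_regions
    (S₁ := {p | p ∈ eF.source ∧ A p ≠ 0 ∧ ‖A p‖ < 1} ×ˢ ball (0 : EuclideanSpace ℝ (Fin 2)) ρ₀)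
    (S₂ := {p | p ∈ eF₃.source ∧ ‖A₃ p‖ < 2 / 3} ×ˢ ball (0 : EuclideanSpace ℝ (Fin 2)) ρ₀)
    (S₃ := {p | p ≠ x₂ ∧ p ∉ {p | p ∈ eF.source ∧ A p ≠ 0 ∧ ‖A p‖ < 1} ∧
      p ∉ {p | p ∈ eF₃.source ∧ ‖A₃ p‖ < 2 / 3}} ×ˢ ball (0 : EuclideanSpace ℝ (Fin 2)) ρ₀)
    (g₁ := fun q => jX (Nk q)) (g₂ := fun q => jP (Ck q)) (g₃ := fun q => jX (T (q.1, Θ q)))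
    ?_ ?_ ?_ ?_ ?_ ?_ ?_ ?_ ?_ ?_
  · -- cover
    rintro ⟨p, w⟩ ⟨hp, hw⟩
    by_cases hN : p ∈ {p | p ∈ eF.source ∧ A p ≠ 0 ∧ ‖A p‖ < 1}
    · exact Or.inl (Or.inl ⟨hN, hw⟩)
    · by_cases hC : p ∈ {p | p ∈ eF₃.source ∧ ‖A₃ p‖ < 2 / 3}
      · exact Or.inl (Or.inr ⟨hC, hw⟩)
      · exact Or.inr ⟨⟨hp, hN, hC⟩, hw⟩
  · -- formula on `R_N × B`
    rintro q ⟨hq, hw⟩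
    exact h1 q ⟨by rw [hUN]; exact ⟨hq.1, hq.2.1, by linarith [hq.2.2]⟩, hw⟩
  · -- formula on `R_C × B`
    rintro q ⟨hq, hw⟩
    exact h2 q ⟨by rw [hUC]; exact ⟨hq.1, by linarith [hq.2]⟩, hw⟩
  · -- formula on `R_F × B`
    rintro q ⟨hq, hw⟩
    exact sheetOne_eq_far_of_region hcx hvc hΘ hϱ₀ hc hPT hN2 hk hNk hUN hΨN hP₃T hC4 hk₃ hρC hCk hUC
      hΨC hDe₁ hDe₂ hglue hNC hFN hFC hcover hΦA hq.1 hq.2.1 hq.2.2 (mem_ball_zero_iff.1 hw)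
  · -- neck injective
    have hinj := NeckPiece.injOn_neckPiece (hcx := hcx) (hA := hA) (hPt := hPt) (hN4 := hN4) (hk := hk0)
      (hNk := hNk) (δ := δN)
    rintro q ⟨hq, hw⟩ q' ⟨hq', hw'⟩ h
    exact hinj ⟨⟨hq.1, hq.2.1⟩, mem_ball_zero_iff.2 (norm_lt_neckRadius (hc := hc) (hϱ₀ := hϱ₀) (hk := hk) (hρN := hρN) (mem_ball_zero_iff.1 hw))⟩
      ⟨⟨hq'.1, hq'.2.1⟩, mem_ball_zero_iff.2 (norm_lt_neckRadius (hc := hc) (hϱ₀ := hϱ₀) (hk := hk) (hρN := hρN) (mem_ball_zero_iff.1 hw'))⟩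
      (hjXi (hNA q.1 hq.1 hq.2.1 _) (hNA q'.1 hq'.1 hq'.2.1 _) h)
  · -- cap injective
    have hA' : ∀ p, A₃ p = ⟨eF₃ p 0, eF₃ p 1⟩ := fun p => by rw [hA₃, hcx]
    have hQt : (affineChart (n := 2) 0 : OpenPartialHomeomorph ComplexProjectivePlane
        (EuclideanSpace ℝ (Fin 4))).target = univ := affineChart_target 0
    have hMk : ∀ (p : F) (w : EuclideanSpace ℝ (Fin 2)), Ck (p, w) =
        (affineChart (n := 2) 0 : OpenPartialHomeomorph ComplexProjectivePlane
          (EuclideanSpace ℝ (Fin 4))).symm (fromC2 (C (A₃ p, (k₃ : ℂ) * ⟨w 0, w 1⟩))) :=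
      fun p w => by rw [hCk, hcx]
    have hinj := ModelPiece.injOn_modelPiece (hA := hA') (hQt := hQt) (hM4 := hC6) (hk := hk₃) (hMk := hMk)
    rintro q ⟨hq, hw⟩ q' ⟨hq', hw'⟩ h
    have hν := norm_capFibre_lt hcx hk₃ hρC (mem_ball_zero_iff.1 hw)
    have hν' := norm_capFibre_lt hcx hk₃ hρC (mem_ball_zero_iff.1 hw')
    rw [hcx] at hν hν'
    exact hinj ⟨hq.1, by linarith [hq.2], hν⟩ ⟨hq'.1, by linarith [hq'.2], hν'⟩
      (hjPi (hCA q) (hCA q') h)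
  · -- far injective
    obtain ⟨Λ, hΛ⟩ : ∃ Λ : F × EuclideanSpace ℝ (Fin 2) → EuclideanSpace ℝ (Fin 2),
        ∀ q, Λ q = vc ((Ψ q.1)⁻¹ * cx q.2) := ⟨_, fun _ => rfl⟩
    have hm0 : ∀ p ∈ {p : F | p ≠ x₂ ∧ p ≠ x₃}, Ψ p ≠ 0 := fun p hp => hΨ0 p hp.1 hp.2
    have hinj := FibreProfile.injOn_linearFar (O := {p : F | p ≠ x₂ ∧ p ≠ x₃}) hcx hvc hT hm0 hΘ hΛ
    rintro q ⟨hq, hw⟩ q' ⟨hq', hw'⟩ h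
    have hm := far_mem_AX_of_region hcx hvc hΘ hFA hϱ₀ hc hPT hN2 hk hNk hUN hNA hΨN hP₃T hC4 hk₃ hρC
      hUC hΨC hDe₁ hDe₂ hglue hcover hAX hq.1 hq.2.1 hq.2.2 (mem_ball_zero_iff.1 hw)
    have hm' := far_mem_AX_of_region hcx hvc hΘ hFA hϱ₀ hc hPT hN2 hk hNk hUN hNA hΨN hP₃T hC4 hk₃ hρC
      hUC hΨC hDe₁ hDe₂ hglue hcover hAX hq'.1 hq'.2.1 hq'.2.2 (mem_ball_zero_iff.1 hw')
    exact hinj ⟨⟨hq.1, hx₃C _ hq.2.2⟩, mem_univ _⟩ ⟨⟨hq'.1, hx₃C _ hq'.2.2⟩, mem_univ _⟩ (hjXi hm hm' h)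
  · -- neck ≠ cap
    rintro q ⟨hq, hw⟩ q' ⟨hq', hw'⟩ h
    obtain ⟨hsrc, -⟩ := hXP _ (hNA q.1 hq.1 hq.2.1 q.2) _ (hCA q') h
    exact hNΦ q.1 hq.1 hq.2.1 q.2 hsrc
  · -- neck ≠ far
    rintro ⟨p₁, w₁⟩ ⟨hq, hw⟩ q' ⟨hq', hw'⟩ h
    have hm' := far_mem_AX_of_region hcx hvc hΘ hFA hϱ₀ hc hPT hN2 hk hNk hUN hNA hΨN hP₃T hC4 hk₃ hρC
      hUC hΨC hDe₁ hDe₂ hglue hcover hAX hq'.1 hq'.2.1 hq'.2.2 (mem_ball_zero_iff.1 hw')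
    have heq : Nk (p₁, w₁) = T (q'.1, Θ q') := hjXi (hNA p₁ hq.1 hq.2.1 w₁) hm' h
    obtain ⟨-, hmemP⟩ := NeckPiece.toC2_neckPiece (hPt := hPt) (hNk := hNk) p₁ w₁
    have hp' : q'.1 ∈ eF.source := hTP q'.1 (Θ q') (heq ▸ hmemP)
    obtain ⟨-, hcoord⟩ := hPT q'.1 hp' (Θ q')
    obtain ⟨-, -, hfirst, -⟩ := NeckPiece.neckPiece_mem (hcx := hcx) (hPt := hPt) (hN2 := hN2) (hN6 := hN6)
      (hk := hk0) (hNk := hNk) (δ := δN) hq.2.1 (norm_lt_neckRadius (hc := hc) (hϱ₀ := hϱ₀) (hk := hk) (hρN := hρN) (mem_ball_zero_iff.1 hw))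
    have hlt1 : ‖A q'.1‖ < 1 := by
      have := hfirst hq.2.2
      rwa [heq, hcoord] at this
    exact hq'.2.1 ⟨hp', hA0 q'.1 hp' hq'.1, hlt1⟩
  · -- cap ≠ far
    rintro ⟨p₂, w₂⟩ ⟨hq, hw⟩ q' ⟨hq', hw'⟩ h
    have hm' := far_mem_AX_of_region hcx hvc hΘ hFA hϱ₀ hc hPT hN2 hk hNk hUN hNA hΨN hP₃T hC4 hk₃ hρC
      hUC hΨC hDe₁ hDe₂ hglue hcover hAX hq'.1 hq'.2.1 hq'.2.2 (mem_ball_zero_iff.1 hw')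
    obtain ⟨hsrc, hΦ⟩ := hXP _ hm' _ (hCA (p₂, w₂)) h.symm
    have hsrc' := hsrc
    rw [ConnectedSumData.mem_Φ_source, hDe₁] at hsrc'
    obtain ⟨hxP, -, hn1⟩ := hsrc'
    have hp' : q'.1 ∈ eF₃.source := hTP₃ q'.1 (Θ q') hxP
    obtain ⟨-, hcoord⟩ := hP₃T q'.1 hp' (Θ q')
    obtain ⟨a, ha⟩ : ∃ a : ℂ, a = A₃ q'.1 := ⟨_, rfl⟩
    have ha23 : 2 / 3 ≤ ‖a‖ := by
      rw [ha]; by_contra hlt; exact hq'.2.2 ⟨hp', not_le.1 hlt⟩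
    have ha0 : a ≠ 0 := fun h0 => by rw [h0, norm_zero] at ha23; norm_num at ha23
    obtain ⟨ν', hν'⟩ : ∃ ν' : ℂ, ν' = a⁻¹ * ((c : ℂ) * cx (Θ q')) := ⟨_, rfl⟩
    have hsec : (c : ℂ) * cx (Θ q') = a * ν' := by
      rw [hν', ← mul_assoc, mul_inv_cancel₀ ha0, one_mul]
    have hPx : P₃ (T (q'.1, Θ q')) = fromC2 (a, a * ν') :=
      toC2_injective (by rw [hcoord, toC2_fromC2, hsec, ha])
    have hnorm := BlowUpCap.norm_fromC2_sheetTube a ν'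
    have hlt : ‖a‖ * Real.sqrt (1 + ‖ν'‖ ^ 2) < 1 := by rw [← hnorm, ← hPx]; exact hn1
    have hz0 : 0 < ‖fromC2 (a, a * ν')‖ := by
      rw [hnorm]; exact mul_pos (norm_pos_iff.2 ha0) (Real.sqrt_pos.2 (by positivity))
    obtain ⟨-, hΦ'⟩ := TubeZones.Φ_eq_of_apply_eq (hDe₁ := hDe₁) (hDe₂ := hDe₂) hxP hPx hz0
      (by rw [hnorm]; exact hlt)
    rw [hΦ', BlowUpCap.affineChart_two_symm_discInversion_sheetTube ha0 hlt, hCk] at hΦ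
    -- compare chart-`0` coordinates
    have hQt : (affineChart (n := 2) 0 : OpenPartialHomeomorph ComplexProjectivePlane
        (EuclideanSpace ℝ (Fin 4))).target = univ := affineChart_target 0
    have e1 := congrArg (affineChart (n := 2) 0 : OpenPartialHomeomorph ComplexProjectivePlane
        (EuclideanSpace ℝ (Fin 4))) hΦ
    rw [(ModelPiece.apply_symm (hQt := hQt) _).1, (ModelPiece.apply_symm (hQt := hQt) _).1] at e1
    have e2 := fromC2_injective e1
    have hνeq : ν' = ((k₃ : ℝ) : ℂ) * cx w₂ := by
      have := congrArg Prod.fst e2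
      rw [hC2] at this
      exact this
    have hK := congrArg (fun z : ℂ × ℂ => ‖z.2‖) e2
    simp only at hK
    rw [norm_farCapCoord ha0 hlt] at hK
    -- the second cap coordinate is too small
    have hνn := norm_capFibre_lt hcx hk₃ hρC (mem_ball_zero_iff.1 hw)
    rw [← hνeq] at hνn
    have hsmall := cap_second_lt (C := C) hC8 hq.2 ha23 hlt hνn
    rw [← hνeq] at hK
    exact absurd hK (ne_of_gt hsmall)

/-! ### §6 Open images and a smooth left inverse of the first sheet -/

include hcx hvc hjX hjXi hjXo hjP hjPi hjPo hT hTo hΨs hΨ0 hΘ hUF hUF₂ hFA hϱ₀ heF heFt hA hP hPt hc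
  hPT hN1 hN2 hN4 hN5 hk hNk hUN hNA hΨN hρN heF₃ heF₃t hA₃ hP₃T hC1 hC4 hC6 hC7 hk₃ hρC hCk hUC
  hCA hΨC hDe₁ hDe₂ hglue hNC hFN hFC hcover hΦA in
/-- **The first sheet maps open subsets of `(T ∖ {x₂}) × B(0, ρ₀)` to open sets.**
[cite: LeeSmoothManifolds2013, Prop. 4.22] -/
theorem isOpen_image_sheetOne [Nonempty F] {jXinv : Z → X}
    (hjXinv : ContMDiffOn (𝓡 4) (𝓡 4) ∞ jXinv (jX '' AX)) (hjXinvl : ∀ x ∈ AX, jXinv (jX x) = x)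
    {jPinv : Z → ComplexProjectivePlane}
    (hjPinv : ContMDiffOn (𝓡 4) (𝓡 4) ∞ jPinv (jP '' AP)) (hjPinvl : ∀ y ∈ AP, jPinv (jP y) = y)
    {O : Set (F × EuclideanSpace ℝ (Fin 2))} (hO : IsOpen O)
    (hOS : O ⊆ {p | p ≠ x₂} ×ˢ ball (0 : EuclideanSpace ℝ (Fin 2)) ρ₀) : IsOpen (ΦA '' O) := by
  obtain ⟨h1, h2, h3⟩ := sheetOne_eqOn hcx hvc hΘ hϱ₀ hc hPT hN2 hk hNk hUN hΨN hP₃T hC4 hk₃ hρC hCk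
    hUC hΨC hDe₁ hDe₂ hglue hNC hFN hFC hΦA
  obtain ⟨-, -, hoF, -⟩ := sheetOne_far_piece hcx hvc hjX hjXi hjXo hT hTo hΨs hΨ0 hΘ hUF hUF₂ hFA
    hjXinv hjXinvl
  obtain ⟨-, -, hoN, -⟩ := sheetOne_neck_piece hcx hvc hjX hjXi hjXo hϱ₀ heF heFt hA hP hPt hc hN1
    hN4 hN5 hk hNk hUN hNA hρN hjXinv hjXinvl
  obtain ⟨-, -, hoC, -⟩ := sheetOne_cap_piece hcx hjP hjPi hjPo heF₃ heF₃t hA₃ hC1 hC6 hC7 hk₃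
    hρC hCk hUC hCA hjPinv hjPinvl
  have hoB : IsOpen (ball (0 : EuclideanSpace ℝ (Fin 2)) ρ₀) := isOpen_ball
  refine Patching.isOpen_image_of_three (U₁ := UN ×ˢ ball (0 : EuclideanSpace ℝ (Fin 2)) ρ₀)
    (U₂ := UC ×ˢ ball (0 : EuclideanSpace ℝ (Fin 2)) ρ₀)
    (U₃ := UF ×ˢ ball (0 : EuclideanSpace ℝ (Fin 2)) ρ₀)
    ((isOpen_UN hcx hA hUN).prod hoB) ((isOpen_UC hcx hA₃ hUC).prod hoB) (hUF.prod hoB)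
    h1 h2 h3 hoN hoC (fun O' hO' hO'W => hoF O' hO' (hO'W.trans (prod_mono le_rfl (subset_univ _))))
    hO ?_
  rintro ⟨p, w⟩ hq
  obtain ⟨hp, hw⟩ := hOS hq
  rcases hcover p hp with h | h | h
  · exact Or.inl (Or.inl ⟨h, hw⟩)
  · exact Or.inl (Or.inr ⟨h, hw⟩)
  · exact Or.inr ⟨h, hw⟩

include hcx hvc hjX hjXi hjXo hjP hjPi hjPo hT hTo hΨs hΨ0 hΘ hUF hUF₂ hFA hϱ₀ heF heFt hA hP hPt hc
  hPT hN1 hN2 hN4 hN5 hk hNk hUN hNA hΨN hρN heF₃ heF₃t hA₃ hP₃T hC1 hC4 hC6 hC7 hk₃ hρC hCk hUC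
  hCA hΨC hDe₁ hDe₂ hglue hNC hFN hFC hcover hΦA hx₂ in
/-- **A smooth left inverse of the first sheet on its image** (patched from the inverses of the
three pieces, given injectivity). [cite: LeeSmoothManifolds2013, Prop. 5.2] -/
theorem exists_inverse_sheetOne [Nonempty F] {jXinv : Z → X}
    (hjXinv : ContMDiffOn (𝓡 4) (𝓡 4) ∞ jXinv (jX '' AX)) (hjXinvl : ∀ x ∈ AX, jXinv (jX x) = x)
    {jPinv : Z → ComplexProjectivePlane}
    (hjPinv : ContMDiffOn (𝓡 4) (𝓡 4) ∞ jPinv (jP '' AP)) (hjPinvl : ∀ y ∈ AP, jPinv (jP y) = y)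
    (hx₂C : x₂ ∉ UC)
    (hinj : InjOn ΦA ({p | p ≠ x₂} ×ˢ ball (0 : EuclideanSpace ℝ (Fin 2)) ρ₀)) :
    ∃ r : Z → F × EuclideanSpace ℝ (Fin 2),
      ContMDiffOn (𝓡 4) ((𝓡 2).prod (𝓡 2)) ∞ r
        (ΦA '' ({p | p ≠ x₂} ×ˢ ball (0 : EuclideanSpace ℝ (Fin 2)) ρ₀)) ∧
      ∀ q ∈ {p | p ≠ x₂} ×ˢ ball (0 : EuclideanSpace ℝ (Fin 2)) ρ₀, r (ΦA q) = q := by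
  obtain ⟨h1, h2, h3⟩ := sheetOne_eqOn hcx hvc hΘ hϱ₀ hc hPT hN2 hk hNk hUN hΨN hP₃T hC4 hk₃ hρC hCk
    hUC hΨC hDe₁ hDe₂ hglue hNC hFN hFC hΦA
  obtain ⟨-, -, -, rF, hrF, hrFl⟩ := sheetOne_far_piece hcx hvc hjX hjXi hjXo hT hTo hΨs hΨ0 hΘ hUF
    hUF₂ hFA hjXinv hjXinvl
  obtain ⟨-, -, -, rN, hrN, hrNl⟩ := sheetOne_neck_piece hcx hvc hjX hjXi hjXo hϱ₀ heF heFt hA hP hPt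
    hc hN1 hN4 hN5 hk hNk hUN hNA hρN hjXinv hjXinvl
  obtain ⟨-, -, -, rC, hrC, hrCl⟩ := sheetOne_cap_piece hcx hjP hjPi hjPo heF₃ heF₃t hA₃ hC1 hC6 hC7
    hk₃ hρC hCk hUC hCA hjPinv hjPinvl
  have hoB : IsOpen (ball (0 : EuclideanSpace ℝ (Fin 2)) ρ₀) := isOpen_ball
  -- the three zones inside `S`
  have hU₁S : UN ×ˢ ball (0 : EuclideanSpace ℝ (Fin 2)) ρ₀ ⊆
      {p | p ≠ x₂} ×ˢ ball (0 : EuclideanSpace ℝ (Fin 2)) ρ₀ :=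
    prod_mono (fun p hp => ne_x₂_of_mem_UN hUN hx₂ hp) le_rfl
  have hU₂S : UC ×ˢ ball (0 : EuclideanSpace ℝ (Fin 2)) ρ₀ ⊆
      {p | p ≠ x₂} ×ˢ ball (0 : EuclideanSpace ℝ (Fin 2)) ρ₀ :=
    prod_mono (fun p hp h => hx₂C (by rw [h] at hp; exact hp)) le_rfl
  have hU₃S : UF ×ˢ ball (0 : EuclideanSpace ℝ (Fin 2)) ρ₀ ⊆
      {p | p ≠ x₂} ×ˢ ball (0 : EuclideanSpace ℝ (Fin 2)) ρ₀ :=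
    prod_mono (fun p hp => (hUF₂ p hp).1) le_rfl
  have hS : {p | p ≠ x₂} ×ˢ ball (0 : EuclideanSpace ℝ (Fin 2)) ρ₀ ⊆
      UN ×ˢ ball (0 : EuclideanSpace ℝ (Fin 2)) ρ₀ ∪ UC ×ˢ ball (0 : EuclideanSpace ℝ (Fin 2)) ρ₀ ∪
        UF ×ˢ ball (0 : EuclideanSpace ℝ (Fin 2)) ρ₀ := by
    rintro ⟨p, w⟩ ⟨hp, hw⟩
    rcases hcover p hp with h | h | h
    · exact Or.inl (Or.inl ⟨h, hw⟩)
    · exact Or.inl (Or.inr ⟨h, hw⟩)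
    · exact Or.inr ⟨h, hw⟩
  have ho : ∀ {U : Set (F × EuclideanSpace ℝ (Fin 2))}, IsOpen U →
      U ⊆ {p | p ≠ x₂} ×ˢ ball (0 : EuclideanSpace ℝ (Fin 2)) ρ₀ → IsOpen (ΦA '' U) :=
    fun hU hUS => isOpen_image_sheetOne hcx hvc hjX hjXi hjXo hjP hjPi hjPo hT hTo hΨs hΨ0 hΘ hUF hUF₂
      hFA hϱ₀ heF heFt hA hP hPt hc hPT hN1 hN2 hN4 hN5 hk hNk hUN hNA hΨN hρN heF₃ heF₃t hA₃ hP₃T hC1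
      hC4 hC6 hC7 hk₃ hρC hCk hUC hCA hΨC hDe₁ hDe₂ hglue hNC hFN hFC hcover hΦA hjXinv hjXinvl hjPinv
      hjPinvl hU hUS
  refine ⟨invFunOn ΦA ({p | p ≠ x₂} ×ˢ ball (0 : EuclideanSpace ℝ (Fin 2)) ρ₀), ?_,
    fun q hq => hinj.leftInvOn_invFunOn hq⟩
  exact Patching.contMDiffOn_leftInverse_of_three hS hU₁S hU₂S hU₃S h1 h2 h3
    (ho ((isOpen_UN hcx hA hUN).prod hoB) hU₁S) (ho ((isOpen_UC hcx hA₃ hUC).prod hoB) hU₂S)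
    (ho (hUF.prod hoB) hU₃S) hrN hrNl hrC hrCl
    (hrF.mono (image_mono (prod_mono le_rfl (subset_univ _))))
    (fun q hq => hrFl q ⟨hq.1, mem_univ _⟩) (fun q hq => hinj.leftInvOn_invFunOn hq)

end SheetOne

end Literature.Topology.FourManifolds
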